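import Mathlib.Data.Finset.Max
import Mathlib.Data.Finset.SymmDiff
import Mathlib.Data.Finset.Card
import Mathlib.Algebra.Group.Nat.Even
import HarnessLib

/-!
# Threshold toggles on finite sets of naturals (glue for the PATH LEMMA of hub-Kleitman, layer 1)

Support file (`--supports stmt-CriticalPhenomena-4575`, closed), prover `prim-cplus-coupling` (gen 51).  No definitions, no notations,
no named facts, no sorries; standard axioms.  Memo `prim-cplus-coupling/A5-COUPLING-gen51.md` §2.

The path lemma (memo-50 §2.8) is proved in gen 51 by factorising every two-sided 'hub move' `E ↦ E ∆ {a, b}`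
(`a ≤ min E`, `b ≥ max E`) into a min-side toggle `E ↦ E ∆ {a}` followed by a max-side toggle, through a canonical
intermediate family.  Each half is the (unique) perfect matching of a tree, and is given by ONE rule: toggle a threshold
that depends only on the maximum (resp. minimum) of the set.  This file proves the two abstract involution lemmas:

* `minToggle_invol` — let `τ : ℕ → ℕ` ('row thresholds') and a finite index set `I` of admissible maxima be given, with at
  most one `M ∈ I` fixed by `τ`, and `M₀` that fixed point if it exists.  On the family
  `𝒦 = {X ≠ ∅ : max X ∈ I, ∀ e ∈ X, τ (max X) ≤ e} ∪ {∅ if some M ∈ I has τ M = M}` the map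
  `X ↦ X ∆ {a X}`, `a X := τ (max X)` (`a ∅ := M₀`), stays in `𝒦`, satisfies `a (X ∆ {a X}) = a X` (so it is an
  involution), toggles an element `≤` every element of `X`, and changes the cardinality by one;
* `maxToggle_invol` — the mirror statement with minima and 'column thresholds'.
[cite: KozmaNitzan2024, Questions 8–9 (§5.5 p. 36) (context)]
-/

namespace Summit.CriticalPhenomena.PercolationContinuityZ3.Theorems

open Finset
open scoped symmDiff

namespace Coefficientwise

/-- Toggling one element changes the cardinality by exactly one, hence flips its parity. [folklore] -/
theorem card_symmDiff_singleton_even_iff (X : Finset ℕ) (a : ℕ) :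
    Even (X ∆ {a}).card ↔ ¬ Even X.card := by
  by_cases ha : a ∈ X
  · have h : X ∆ {a} = X.erase a := by
      ext e
      simp only [mem_symmDiff, mem_singleton, mem_erase]
      constructor
      · rintro (⟨he, hne⟩ | ⟨rfl, hna⟩)
        · exact ⟨hne, he⟩
        · exact absurd ha hna
      · rintro ⟨hne, he⟩
        exact Or.inl ⟨he, hne⟩
    rw [h, card_erase_of_mem ha]
    have hpos : 0 < X.card := card_pos.mpr ⟨a, ha⟩
    obtain ⟨k, hk⟩ : ∃ k, X.card = k + 1 := ⟨X.card - 1, by omega⟩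
    rw [hk, Nat.add_sub_cancel, Nat.even_add_one]
    exact not_not.symm
  · have h : X ∆ {a} = insert a X := by
      ext e
      simp only [mem_symmDiff, mem_singleton, mem_insert]
      constructor
      · rintro (⟨he, _⟩ | ⟨rfl, _⟩)
        · exact Or.inr he
        · exact Or.inl rfl
      · rintro (rfl | he)
        · exact Or.inr ⟨rfl, ha⟩
        · exact Or.inl ⟨he, fun h => ha (h ▸ he)⟩
    rw [h, card_insert_of_notMem ha, Nat.even_add_one]

/-- **Min-side threshold toggle is an involution.**  `τ` = row thresholds, `I` = admissible maxima, at most one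
fixed point of `τ` in `I` (`M₀` if it exists).  The family is
`𝒦 X :⟺ (X = ∅ ∧ ∃ M ∈ I, τ M = M) ∨ (X ≠ ∅ ∧ max X ∈ I ∧ ∀ e ∈ X, τ (max X) ≤ e)`
and the toggled element is `a X = τ (max X)` (`M₀` for `X = ∅`).  Conclusion: the toggled set is again in `𝒦`, has the
same toggled element, and the toggled element is `≤` every element of `X`. [folklore] -/
theorem minToggle_invol (I : Finset ℕ) (τ : ℕ → ℕ) (M₀ : ℕ)
    (hτ : ∀ M ∈ I, τ M ≤ M)
    (huniq : ∀ M ∈ I, ∀ M' ∈ I, τ M = M → τ M' = M' → M = M')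
    (hM₀ : (∃ M ∈ I, τ M = M) → M₀ ∈ I ∧ τ M₀ = M₀)
    (a : Finset ℕ → ℕ) (ha : ∀ X : Finset ℕ, a X = if h : X.Nonempty then τ (X.max' h) else M₀)
    (X : Finset ℕ)
    (hX : (X = ∅ ∧ ∃ M ∈ I, τ M = M) ∨ (∃ h : X.Nonempty, X.max' h ∈ I ∧ ∀ e ∈ X, τ (X.max' h) ≤ e)) :
    ((X ∆ {a X} = ∅ ∧ ∃ M ∈ I, τ M = M) ∨
      (∃ h : (X ∆ {a X}).Nonempty, (X ∆ {a X}).max' h ∈ I ∧ ∀ e ∈ X ∆ {a X}, τ ((X ∆ {a X}).max' h) ≤ e)) ∧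
    a (X ∆ {a X}) = a X ∧ (∀ e ∈ X, a X ≤ e) := by
  classical
  rcases hX with ⟨rfl, hfix⟩ | ⟨hne, hMI, hlow⟩
  · -- X = ∅ : a ∅ = M₀, the toggled set is {M₀}
    obtain ⟨hM₀I, hM₀fix⟩ := hM₀ hfix
    have haX : a ∅ = M₀ := by rw [ha]; simp
    have hY : (∅ : Finset ℕ) ∆ {a ∅} = {M₀} := by rw [haX]; simp
    rw [hY]
    refine ⟨Or.inr ⟨singleton_nonempty _, ?_, ?_⟩, ?_, ?_⟩
    · simpa using hM₀I
    · intro e he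
      rw [mem_singleton] at he
      subst he
      simp [hM₀fix]
    · rw [ha, haX]
      simp [hM₀fix]
    · intro e he
      simp at he
  · set M := X.max' hne with hMdef
    have haX : a X = τ M := by rw [ha, dif_pos hne]
    have htM : τ M ≤ M := hτ M hMI
    by_cases htin : τ M ∈ X
    · -- removal case
      have hY : X ∆ {a X} = X.erase (τ M) := by
        ext e
        simp only [haX, mem_symmDiff, mem_singleton, mem_erase]
        constructor
        · rintro (⟨he, hne'⟩ | ⟨rfl, hna⟩)
          · exact ⟨hne', he⟩
          · exact absurd htin hna
        · rintro ⟨hne', he⟩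
          exact Or.inl ⟨he, hne'⟩
      rw [hY]
      by_cases hsing : X.erase (τ M) = ∅
      · -- X = {τ M}, so M = τ M is a fixed point
        have hXeq : X = {τ M} := by
          ext e
          constructor
          · intro he
            rw [mem_singleton]
            by_contra hne'
            have : e ∈ X.erase (τ M) := mem_erase.mpr ⟨hne', he⟩
            rw [hsing] at this
            simp at this
          · intro he
            rw [mem_singleton] at he
            rw [he]
            exact htin
        have hMfix : τ M = M := by
          have : M ∈ X := max'_mem X hne
          rw [hXeq, mem_singleton] at this
          exact this.symm
        refine ⟨Or.inl ⟨hsing, M, hMI, hMfix⟩, ?_, ?_⟩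
        · rw [hsing, ha, haX]
          simp only [Finset.not_nonempty_empty, dif_neg, not_false_eq_true]
          obtain ⟨hM₀I, hM₀fix⟩ := hM₀ ⟨M, hMI, hMfix⟩
          rw [huniq M₀ hM₀I M hMI hM₀fix hMfix, hMfix]
        · intro e he
          rw [haX]
          exact hlow e he
      · have hYne : (X.erase (τ M)).Nonempty := nonempty_iff_ne_empty.mpr hsing
        -- max unchanged: M ≠ τ M since X has another element
        have hMne : M ≠ τ M := by
          intro hMt
          obtain ⟨e, he⟩ := hYne
          rw [mem_erase] at he
          have h1 : τ M ≤ e := hlow e he.2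
          have h2 : e ≤ M := le_max' X e he.2
          exact he.1 (by omega)
        have hMY : M ∈ X.erase (τ M) := mem_erase.mpr ⟨hMne, max'_mem X hne⟩
        have hmaxY : (X.erase (τ M)).max' hYne = M := by
          apply le_antisymm
          · exact max'_le _ hYne _ fun e he => le_max' X e (mem_of_mem_erase he)
          · exact le_max' _ M hMY
        refine ⟨Or.inr ⟨hYne, ?_, ?_⟩, ?_, ?_⟩
        · rw [hmaxY]; exact hMI
        · intro e he
          rw [hmaxY]
          exact hlow e (mem_of_mem_erase he)
        · rw [ha, dif_pos hYne, hmaxY, haX]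
        · intro e he
          rw [haX]
          exact hlow e he
    · -- insertion case
      have hY : X ∆ {a X} = insert (τ M) X := by
        ext e
        simp only [haX, mem_symmDiff, mem_singleton, mem_insert]
        constructor
        · rintro (⟨he, _⟩ | ⟨rfl, _⟩)
          · exact Or.inr he
          · exact Or.inl rfl
        · rintro (rfl | he)
          · exact Or.inr ⟨rfl, htin⟩
          · exact Or.inl ⟨he, fun h => htin (h ▸ he)⟩
      rw [hY]
      have hYne : (insert (τ M) X).Nonempty := insert_nonempty _ _
      have hmaxY : (insert (τ M) X).max' hYne = M := by
        rw [max'_insert (τ M) X hne]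
        exact max_eq_right htM
      refine ⟨Or.inr ⟨hYne, ?_, ?_⟩, ?_, ?_⟩
      · rw [hmaxY]; exact hMI
      · intro e he
        rw [hmaxY]
        rcases mem_insert.mp he with rfl | he
        · exact le_rfl
        · exact hlow e he
      · rw [ha, dif_pos hYne, hmaxY, haX]
      · intro e he
        rw [haX]
        exact hlow e he

/-- **Max-side threshold toggle is an involution** (mirror of `minToggle_invol`): `τ` = column thresholds,
`I` = admissible minima, at most one fixed point (`m₀`); family
`𝒦' X :⟺ (X = ∅ ∧ ∃ m ∈ I, τ m = m) ∨ (X ≠ ∅ ∧ min X ∈ I ∧ ∀ e ∈ X, e ≤ τ (min X))`; toggled element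
`b X = τ (min X)` (`m₀` for `∅`). [folklore] -/
theorem maxToggle_invol (I : Finset ℕ) (τ : ℕ → ℕ) (m₀ : ℕ)
    (hτ : ∀ m ∈ I, m ≤ τ m)
    (huniq : ∀ m ∈ I, ∀ m' ∈ I, τ m = m → τ m' = m' → m = m')
    (hm₀ : (∃ m ∈ I, τ m = m) → m₀ ∈ I ∧ τ m₀ = m₀)
    (b : Finset ℕ → ℕ) (hb : ∀ X : Finset ℕ, b X = if h : X.Nonempty then τ (X.min' h) else m₀)
    (X : Finset ℕ)
    (hX : (X = ∅ ∧ ∃ m ∈ I, τ m = m) ∨ (∃ h : X.Nonempty, X.min' h ∈ I ∧ ∀ e ∈ X, e ≤ τ (X.min' h))) :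
    ((X ∆ {b X} = ∅ ∧ ∃ m ∈ I, τ m = m) ∨
      (∃ h : (X ∆ {b X}).Nonempty, (X ∆ {b X}).min' h ∈ I ∧ ∀ e ∈ X ∆ {b X}, e ≤ τ ((X ∆ {b X}).min' h))) ∧
    b (X ∆ {b X}) = b X ∧ (∀ e ∈ X, e ≤ b X) := by
  classical
  rcases hX with ⟨rfl, hfix⟩ | ⟨hne, hmI, hup⟩
  · obtain ⟨hm₀I, hm₀fix⟩ := hm₀ hfix
    have hbX : b ∅ = m₀ := by rw [hb]; simp
    have hY : (∅ : Finset ℕ) ∆ {b ∅} = {m₀} := by rw [hbX]; simp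
    rw [hY]
    refine ⟨Or.inr ⟨singleton_nonempty _, ?_, ?_⟩, ?_, ?_⟩
    · simpa using hm₀I
    · intro e he
      rw [mem_singleton] at he
      subst he
      simp [hm₀fix]
    · rw [hb, hbX]
      simp [hm₀fix]
    · intro e he
      simp at he
  · set m := X.min' hne with hmdef
    have hbX : b X = τ m := by rw [hb, dif_pos hne]
    have htm : m ≤ τ m := hτ m hmI
    by_cases htin : τ m ∈ X
    · have hY : X ∆ {b X} = X.erase (τ m) := by
        ext e
        simp only [hbX, mem_symmDiff, mem_singleton, mem_erase]
        constructor
        · rintro (⟨he, hne'⟩ | ⟨rfl, hna⟩)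
          · exact ⟨hne', he⟩
          · exact absurd htin hna
        · rintro ⟨hne', he⟩
          exact Or.inl ⟨he, hne'⟩
      rw [hY]
      by_cases hsing : X.erase (τ m) = ∅
      · have hXeq : X = {τ m} := by
          ext e
          constructor
          · intro he
            rw [mem_singleton]
            by_contra hne'
            have : e ∈ X.erase (τ m) := mem_erase.mpr ⟨hne', he⟩
            rw [hsing] at this
            simp at this
          · intro he
            rw [mem_singleton] at he
            rw [he]
            exact htin
        have hmfix : τ m = m := by
          have : m ∈ X := min'_mem X hne
          rw [hXeq, mem_singleton] at this
          exact this.symm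
        refine ⟨Or.inl ⟨hsing, m, hmI, hmfix⟩, ?_, ?_⟩
        · rw [hsing, hb, hbX]
          simp only [Finset.not_nonempty_empty, dif_neg, not_false_eq_true]
          obtain ⟨hm₀I, hm₀fix⟩ := hm₀ ⟨m, hmI, hmfix⟩
          rw [huniq m₀ hm₀I m hmI hm₀fix hmfix, hmfix]
        · intro e he
          rw [hbX]
          exact hup e he
      · have hYne : (X.erase (τ m)).Nonempty := nonempty_iff_ne_empty.mpr hsing
        have hmne : m ≠ τ m := by
          intro hmt
          obtain ⟨e, he⟩ := hYne
          rw [mem_erase] at he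
          have h1 : e ≤ τ m := hup e he.2
          have h2 : m ≤ e := min'_le X e he.2
          exact he.1 (by omega)
        have hmY : m ∈ X.erase (τ m) := mem_erase.mpr ⟨hmne, min'_mem X hne⟩
        have hminY : (X.erase (τ m)).min' hYne = m := by
          apply le_antisymm
          · exact min'_le _ m hmY
          · exact le_min' _ hYne _ fun e he => min'_le X e (mem_of_mem_erase he)
        refine ⟨Or.inr ⟨hYne, ?_, ?_⟩, ?_, ?_⟩
        · rw [hminY]; exact hmI
        · intro e he
          rw [hminY]
          exact hup e (mem_of_mem_erase he)
        · rw [hb, dif_pos hYne, hminY, hbX]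
        · intro e he
          rw [hbX]
          exact hup e he
    · have hY : X ∆ {b X} = insert (τ m) X := by
        ext e
        simp only [hbX, mem_symmDiff, mem_singleton, mem_insert]
        constructor
        · rintro (⟨he, _⟩ | ⟨rfl, _⟩)
          · exact Or.inr he
          · exact Or.inl rfl
        · rintro (rfl | he)
          · exact Or.inr ⟨rfl, htin⟩
          · exact Or.inl ⟨he, fun h => htin (h ▸ he)⟩
      rw [hY]
      have hYne : (insert (τ m) X).Nonempty := insert_nonempty _ _
      have hminY : (insert (τ m) X).min' hYne = m := by
        rw [min'_insert (τ m) X hne]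
        exact min_eq_right htm
      refine ⟨Or.inr ⟨hYne, ?_, ?_⟩, ?_, ?_⟩
      · rw [hminY]; exact hmI
      · intro e he
        rw [hminY]
        rcases mem_insert.mp he with rfl | he
        · exact le_rfl
        · exact hup e he
      · rw [hb, dif_pos hYne, hminY, hbX]
      · intro e he
        rw [hbX]
        exact hup e he

end Coefficientwise

end Summit.CriticalPhenomena.PercolationContinuityZ3.Theorems
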